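import Summits.HubbardSuperconductivity.HubbardSuperconductivity.Theorems.AnisotropyChordTransferFibre3RowCSharp

/-!
# Route `AnisotropyChord` / H0 rotor rung, row C (KT-2b): the η-FACTORISED sharp cell program `rowCEF` / `rowCCellCheckF` and its
soundness ★★★ `RowC.offPoleTail_of_rowCCheckF`

The interval-loss cure named by theory-1 g23 (PartN41-E CAVEAT) and the director (D4′ (ii)): in the sharp row-C program
`rowCSE` (`…RowCSharp`) both sides scale like `η² = π⁴ν²`, so on a ν-column `[ν₁, ν₂]` the kernel evaluation compares `lhs(ν₂)` with
`rhs(ν₁)` and loses `(ν₂/ν₁)² ≈ 1.3`.  Here every closed form is divided by the right power of `η` SYMBOLICALLY (`c_s = η·ĉ`,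
`X = η²X₁`, `τ̄ = ητ₁`, `t·R̄ = η²·(t/η)(τ₁ − 2η)`, `ξ = ηξ₁`, `ζ = ηζ₁`, `κ_w = η²κ₁`, `cr = η²cr₁`, `‖T₀s‖² = η²lap₁` (using `ν = η/π²`),
`Ψ⁺ = η²Ψ₁`, `δ = ηδ₁`, `bulk = η²bulk₁`, `Bxx = η²Bxx₁`, `ZwS = η²ZwS₁`, `NhiS = η²Nhi₁`, `Chi = η²Chi₁`) and the right-hand side
`48π⁴b·η·(2ê₁ − τ)·τ` by `η²` as `48π²b(2ê₁ − τ)(3 − (3/2)Q̂₁/(P̂ν))`: ★ `rowCEF xshi bC`, ★ `rowCCellCheckF` (same box, same side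
checks).  ★★ `eval_rowCSE_eq_factor`: `rowCSE = η²·rowCEF` IDENTICALLY at every vector with `y₁ = π²`, `y₂ = ν > 0` (exact algebra,
`√(η⁴z) = η²√z`, `max(η²a, η²b) = η²max(a,b)`), hence `rowC_coreF` and ★★★ `offPoleTail_of_rowCCheckF` (verbatim the sharp soundness
with the factorised check).  No `min`/t-band yet (§2 `ChiNT` is the next variant).
Prover seat `hubbard-h0-rotor-p1` g29 (route lead); helper for piece A = stmt-HubbardSuperconductivity-23918 of rung 19089
(`--supports`, helper class).  Nothing here proves superconductivity in the Hubbard model; one kernel program + soundness of ONE row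
of ONE conditional reduction; the rotor TARGET as originally worded stays FALSE (g15 verdict).  Tree imports only; no sorry.
-/

set_option linter.dupNamespace false
set_option autoImplicit false

open Literature.Analysis.ValidatedNumerics

namespace Summit.HubbardSuperconductivity.HubbardSuperconductivity.Theorems.AnisotropyChord.Transfer.Fibre3

namespace RowC

open L2.N1

variable (L : ℕ) [NeZero L]

/-! ## The η-FACTORISED sharp program (every closed form divided by the right power of `η = π²ν` symbolically) -/

/-- `ĉ := c_s/η = 4(1 + at/4π²)`. -/
def cHE : RExpr := .mul (cst 4) (.add (cst 1) (.mul (.mul yA yT) (.inv fourPi2)))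
/-- `X/η² = ĉ²·xshi/(8π²) − ê₁t`. -/
def X1E (xshi : ℚ) : RExpr := .sub (.mul (.mul (.sq cHE) (cst xshi)) (.inv (.mul (cst 8) yPi2))) (.mul yE1 yT)
/-- `τ̄/η = 2(1 − a) + 2(t + t‖s‖² − t(1−a)²)/4π²`. -/
def tau1E : RExpr :=
  .add (.mul (cst 2) (.sub (cst 1) yA))
    (.mul (.mul (cst 2) (.sub (.add yT ts2E) (.mul yT (.sq (.sub (cst 1) yA))))) (.inv fourPi2))
/-- `t·R̄/η² = (t/η)·(τ̄/η − 2η)`. -/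
def TR1E : RExpr := .mul (.mul yT (.inv etaE)) (.sub tau1E (.mul (cst 2) etaE))
/-- ★ `Chi/η²`. -/
def Chi1E (xshi : ℚ) : RExpr :=
  .add (.add (.mul (.mul (.mul (cst 4) yE1) tQ0E) (X1E xshi))
      (.mul (.mul yE1 TR1E) (.add GamE (.mul (.mul (cst 2) (.sq fnnE)) (.sq MNE)))))
    (.mul (.mul (cst 2) yE1) (.sqrt (.mul (.mul (.mul (.mul (cst 4) tQ0E) (X1E xshi)) GamE) TR1E)))
/-- `ξ/η`, `ζ/η`. -/
def xi1E : RExpr := .mul cHE (.sub yK20 k10E)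
/-- see `xi1E`. -/
def ze1E : RExpr := .mul cHE (.sub yK11 k10E)
/-- `κ_w/η² = 2 + (ξ/η)² + 2(ζ/η)²`. -/
def kap1E : RExpr := .add (.add (cst 2) (.sq xi1E)) (.mul (cst 2) (.sq ze1E))
/-- `crossW/η² = 1 − 2ζ/η + 2(ξ/η)(ζ/η)`. -/
def cr1E : RExpr := .add (.sub (cst 1) (.mul (cst 2) ze1E)) (.mul (.mul (cst 2) xi1E) ze1E)
/-- `‖T₀s‖²/η² = ĉ²(1 − t/4π²)/4 + ĉ·t·(1 − a + at/4π²)/(2π²) + ĉ²ν²x₄t/(16π²)` (`ν = η/π²` in the middle term). -/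
def lap1E : RExpr :=
  .add (.add (.mul (.mul (.sq cHE) (.sub (cst 1) (.mul yT (.inv fourPi2)))) (cst (1/4)))
      (.mul (.mul (.mul cHE yT) (.add (.sub (cst 1) yA) (.mul (.mul yA yT) (.inv fourPi2)))) (.inv (.mul (cst 2) yPi2))))
    (.mul (.mul (.mul (.mul (.sq cHE) (.sq yNu)) yX4) yT) (.inv (.mul (cst 16) yPi2)))
/-- `Ψ⁺/η² = 8(τ̄/η − η·κ_w/η²)² + 8η²·max(cr/η², lap/4η² − cr/η²)²`. -/
def Psi1E : RExpr :=
  .add (.mul (cst 8) (.sq (.sub tau1E (.mul etaE kap1E))))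
    (.mul (.mul (cst 8) (.sq etaE)) (.sq (.max cr1E (.sub (.mul lap1E (cst (1/4))) cr1E))))
/-- `δ/η = 1 + 0.001ĉ`. -/
def del1E : RExpr := .add (cst 1) (.mul (cst 0.001) cHE)
/-- `bulk/η² = η·(17f²(δ/η)² + 8(ξ/η)²M² + 16(ζ/η)²M²)·(τ̄/η)`. -/
def bulk1E : RExpr :=
  .mul (.mul etaE (.add (.add (.mul (.mul (cst 17) (.sq fnnE)) (.sq del1E)) (.mul (.mul (cst 8) (.sq xi1E)) (.sq MNE)))
    (.mul (.mul (cst 16) (.sq ze1E)) (.sq MNE)))) tau1E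
/-- `Bxx/η² = ĉ²(0.00384a + 0.00176·η·ĉ)`, `Bxy/η²`. -/
def Bxx1E : RExpr := .mul (.sq cHE) (.add (.mul (cst 0.00384) yA) (.mul (.mul (cst 0.00176) etaE) cHE))
/-- see `Bxx1E`. -/
def Bxy1E : RExpr := .mul (.sq cHE) (.add (.mul (cst 0.0118) yA) (.mul (.mul (cst 0.0035) etaE) cHE))
/-- `ZwS/η² = η²(2(Bxx/η²)² + 4(Bxy/η²)²)`. -/
def ZwS1E : RExpr := .mul (.sq etaE) (.add (.mul (cst 2) (.sq Bxx1E)) (.mul (cst 4) (.sq Bxy1E)))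
/-- ★ `NhiS/η²`. -/
def Nhi1E : RExpr := .add (.mul (.mul (cst (9/4)) (.sq MNE)) Psi1E) (.mul (cst 12) (.add ZwS1E bulk1E))
/-- ★ THE η-FACTORISED SHARP ROW-C INEQUALITY `9(√(Chi/η²) + √(NhiS/η²))² − 48π²·bC·(2ê₁ − τ)·(3 − (3/2)·Q̂₁/(P̂ν))` (claim `≤ 0`;
`= rowCSE/η²`: the ν-width of a column no longer enters through `η²`). -/
def rowCEF (xshi bC : ℚ) : RExpr :=
  .sub (.mul (cst 9) (.sq (.add (.sqrt (Chi1E xshi)) (.sqrt Nhi1E))))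
    (.mul (.mul (.mul (.mul (cst 48) yPi2) (cst bC)) (.sub (.mul (cst 2) yE1) tauE))
      (.sub (cst 3) (.mul (.mul (.mul (cst (3/2)) yQ) (.inv yP)) (.inv yNu))))

/-- ★ THE η-FACTORISED SHARP ROW-C CELL CHECK (same box and side checks as `rowCCellCheckS`, `rowCEF` for `rowCSE`). -/
def rowCCellCheckF (c : L2.NamedCell) (a1 a2 xshi bC : ℚ) (pi : ℕ × ℕ) : Bool :=
  match cellFinalBoxC c a1 a2 2 pi with
  | none => false
  | some F =>
    decide (F.length = 10) &&
    rexprLeOn (rowCEF xshi bC) 0 (rowCBox c F) pi &&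
    rexprLeOn (.neg yP) (-1) (rowCBox c F) pi &&
    rexprLeOn (.neg tauE) 0 (rowCBox c F) pi &&
    rexprLeOn (.sub tauE (.mul (cst 2) yE1)) 0 (rowCBox c F) pi

/-! ## The factorisation identities: `(closed form).eval = η^k · (factorised form).eval`, `η = π²ν` -/

section ids
variable (y : ℕ → ℝ) (hπ : y 1 = Real.pi ^ 2) (hν : 0 < y 2)
include hπ

/-- `c_s = η·ĉ`. -/
theorem ev_cs : csE.eval y = (Real.pi ^ 2 * y 2) * cHE.eval y := by
  simp only [csE, cHE, etaE, fourPi2, yPi2, yNu, yA, yT, cst, RExpr.eval, hπ]; push_cast; ring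

/-- `X = η²·X₁`. -/
theorem ev_X (xshi : ℚ) : (XE xshi).eval y = (Real.pi ^ 2 * y 2) ^ 2 * (X1E xshi).eval y := by
  have hc := ev_cs y hπ
  simp only [XE, X1E, etaE, yPi2, yNu, yE1, yT, cst, RExpr.eval, hπ] at *
  rw [hc]; push_cast; ring

/-- `τ̄ = η·τ₁`. -/
theorem ev_tau : tauNE.eval y = (Real.pi ^ 2 * y 2) * tau1E.eval y := by
  simp only [tauNE, tau1E, etaE, fourPi2, yPi2, yNu, yA, yT, cst, RExpr.eval, hπ]; push_cast; ring

include hν in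
/-- `t·R̄ = η²·TR₁`. -/
theorem ev_TR : y 0 * RbE.eval y = (Real.pi ^ 2 * y 2) ^ 2 * TR1E.eval y := by
  have hτ := ev_tau y hπ
  have hE : Real.pi ^ 2 * y 2 ≠ 0 := by positivity
  simp only [RbE, TR1E, etaE, yPi2, yNu, yT, cst, RExpr.eval, hπ] at *
  rw [hτ]; field_simp

include hν in
/-- ★ `Chi = η²·Chi₁`. -/
theorem ev_Chi (xshi : ℚ) : (ChiE xshi).eval y = (Real.pi ^ 2 * y 2) ^ 2 * (Chi1E xshi).eval y := by
  have hX := ev_X y hπ xshi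
  have hT := ev_TR y hπ hν
  set E : ℝ := Real.pi ^ 2 * y 2 with hE
  have hE0 : 0 ≤ E ^ 2 := sq_nonneg _
  simp only [ChiE, Chi1E, yE1, yT, cst, RExpr.eval] at *
  -- the square-root argument
  have harg : 4 * y 0 * tQ0E.eval y * (XE xshi).eval y * GamE.eval y * RbE.eval y
      = (E ^ 2) ^ 2 * (4 * tQ0E.eval y * (X1E xshi).eval y * GamE.eval y * TR1E.eval y) := by
    have : 4 * y 0 * tQ0E.eval y * (XE xshi).eval y * GamE.eval y * RbE.eval y
        = 4 * tQ0E.eval y * (XE xshi).eval y * GamE.eval y * (y 0 * RbE.eval y) := by ring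
    rw [this, hT, hX]; ring
  have hsq : Real.sqrt (4 * y 0 * tQ0E.eval y * (XE xshi).eval y * GamE.eval y * RbE.eval y)
      = E ^ 2 * Real.sqrt (4 * tQ0E.eval y * (X1E xshi).eval y * GamE.eval y * TR1E.eval y) := by
    rw [harg, Real.sqrt_mul (sq_nonneg _), Real.sqrt_sq hE0]
  have hmid : y 4 * y 0 * RbE.eval y = y 4 * (E ^ 2 * TR1E.eval y) := by rw [← hT]; ring
  push_cast at *
  rw [hsq, hX]
  have e2 : y 4 * y 0 * RbE.eval y * (GamE.eval y + 2 * fnnE.eval y ^ 2 * MNE.eval y ^ 2)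
      = E ^ 2 * (y 4 * TR1E.eval y * (GamE.eval y + 2 * fnnE.eval y ^ 2 * MNE.eval y ^ 2)) := by
    rw [hmid]; ring
  rw [e2]; ring

/-- `ξ = η·ξ₁`, `ζ = η·ζ₁`. -/
theorem ev_xi : xiE.eval y = (Real.pi ^ 2 * y 2) * xi1E.eval y ∧ zeE.eval y = (Real.pi ^ 2 * y 2) * ze1E.eval y := by
  have hc := ev_cs y hπ
  simp only [xiE, zeE, xi1E, ze1E, RExpr.eval] at *
  rw [hc]; exact ⟨by ring, by ring⟩

/-- `κ_w = η²κ₁`, `cr = η²cr₁`, `lap = η²lap₁`, `δ = ηδ₁`. -/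
theorem ev_kap_cr_lap_del :
    kapE.eval y = (Real.pi ^ 2 * y 2) ^ 2 * kap1E.eval y ∧ crE.eval y = (Real.pi ^ 2 * y 2) ^ 2 * cr1E.eval y ∧
    lapE.eval y = (Real.pi ^ 2 * y 2) ^ 2 * lap1E.eval y ∧ delE.eval y = (Real.pi ^ 2 * y 2) * del1E.eval y := by
  obtain ⟨hx, hz⟩ := ev_xi y hπ
  have hc := ev_cs y hπ
  have hπ0 : Real.pi ^ 2 ≠ 0 := by positivity
  refine ⟨?_, ?_, ?_, ?_⟩
  · simp only [kapE, kap1E, etaE, yPi2, yNu, cst, RExpr.eval, hπ] at *; rw [hx, hz]; push_cast; ring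
  · simp only [crE, cr1E, etaE, yPi2, yNu, cst, RExpr.eval, hπ] at *; rw [hx, hz]; push_cast; ring
  · simp only [lapE, lap1E, fourPi2, yPi2, yNu, yA, yT, yX4, cst, RExpr.eval, hπ] at *; rw [hc]; field_simp; push_cast; ring
  · simp only [delE, del1E, etaE, yPi2, yNu, cst, RExpr.eval, hπ] at *; rw [hc]; push_cast; ring

/-- `Ψ⁺ = η²Ψ₁`. -/
theorem ev_Psi : PsiE.eval y = (Real.pi ^ 2 * y 2) ^ 2 * Psi1E.eval y := by
  obtain ⟨hk, hcr, hl, -⟩ := ev_kap_cr_lap_del y hπ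
  have hτ := ev_tau y hπ
  set E : ℝ := Real.pi ^ 2 * y 2 with hE
  have hE2 : 0 ≤ E ^ 2 := sq_nonneg _
  simp only [PsiE, Psi1E, etaE, yPi2, yNu, cst, RExpr.eval, hπ] at *
  rw [hτ, hk, hcr, hl, ← hE]
  have hmax : max (E ^ 2 * cr1E.eval y) (E ^ 2 * lap1E.eval y * (((1:ℚ)/4 : ℚ) : ℝ) - E ^ 2 * cr1E.eval y)
      = E ^ 2 * max (cr1E.eval y) (lap1E.eval y * (((1:ℚ)/4 : ℚ) : ℝ) - cr1E.eval y) := by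
    rw [mul_max_of_nonneg _ _ hE2]; congr 1; ring
  rw [hmax]; push_cast; ring

/-- `bulk = η²·bulk₁`. -/
theorem ev_bulk : bulkE.eval y = (Real.pi ^ 2 * y 2) ^ 2 * bulk1E.eval y := by
  obtain ⟨hx, hz⟩ := ev_xi y hπ
  obtain ⟨-, -, -, hd⟩ := ev_kap_cr_lap_del y hπ
  have hτ := ev_tau y hπ
  simp only [bulkE, bulk1E, etaE, yPi2, yNu, cst, RExpr.eval, hπ] at *
  rw [hx, hz, hd, hτ]; push_cast; ring

/-- `ZwS = η²·ZwS₁`, `NhiS = η²·Nhi₁`. -/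
theorem ev_Nhi : ZwSE.eval y = (Real.pi ^ 2 * y 2) ^ 2 * ZwS1E.eval y ∧ NhiSE.eval y = (Real.pi ^ 2 * y 2) ^ 2 * Nhi1E.eval y := by
  have hc := ev_cs y hπ
  have hP := ev_Psi y hπ
  have hB := ev_bulk y hπ
  have hZ : ZwSE.eval y = (Real.pi ^ 2 * y 2) ^ 2 * ZwS1E.eval y := by
    simp only [ZwSE, BxxE, BxyE, ZwS1E, Bxx1E, Bxy1E, etaE, yPi2, yNu, yA, cst, RExpr.eval, hπ] at *
    rw [hc]; push_cast; ring
  refine ⟨hZ, ?_⟩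
  simp only [NhiSE, Nhi1E, cst, RExpr.eval] at *
  rw [hZ, hP, hB]; push_cast; ring

include hν in
/-- ★★ THE MASTER IDENTITY: `rowCSE = η²·rowCEF` at any vector with `y₁ = π²`, `y₂ = ν > 0`. -/
theorem eval_rowCSE_eq_factor (xshi bC : ℚ) :
    (rowCSE xshi bC).eval y = (Real.pi ^ 2 * y 2) ^ 2 * (rowCEF xshi bC).eval y := by
  have hC := ev_Chi y hπ hν xshi
  have hN := (ev_Nhi y hπ).2
  set E : ℝ := Real.pi ^ 2 * y 2 with hE
  have hE0 : 0 ≤ E := by positivity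
  have hE2 : 0 ≤ E ^ 2 := sq_nonneg _
  have hν0 : y 2 ≠ 0 := hν.ne'
  simp only [rowCSE, rowCEF, etaE, tauE, yPi2, yNu, yE1, yQ, yP, cst, RExpr.eval, hπ] at *
  rw [hC, hN, Real.sqrt_mul hE2, Real.sqrt_mul hE2, Real.sqrt_sq hE0]
  rw [hE]; field_simp

end ids

end RowC

end Summit.HubbardSuperconductivity.HubbardSuperconductivity.Theorems.AnisotropyChord.Transfer.Fibre3
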